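import Summits.Ventures.Crystal3D.Theorems.StickyWulffConstantCoaxialWallLawEndUniqueGen
import HarnessLib

/-!
# LEMMA X″ at every version: a bottom class and a TOP (basal-letter) class of the same root never share a target
# (crux `CoaxialWallLaw`, stmt-Ventures-19481, line `WallLedgerF`; v2 transition, twin two-plate union)

HONEST FRAMING. Venture `Summits/Ventures/Crystal3D` (cell `crystal3d-full`), helper `--supports` the crux
`CoaxialWallLaw` of `route-Ventures-StickyWulffConstant` (REGISTERED line `WallLedgerF`).  Rung credit; F-C1 not
moved; no census, no kissing facts; pure word algebra.  cf-p1 g28 (xxxviii″): in the twin two-plate row cell the TOP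
plate's classes are written over the bottom base frame as chains `l ++ [e]` whose DEEPEST letter is the model basal
normal `e` (`⟪r, e⟫ = 0` for an in-plane root `r`), the other letters oblique to `r`; the bottom plate's classes are
chains all of whose letters are oblique to `r`.  The v1 two-plate separation `word_target_ne_of_root_deepest`
(`…EndUniqueTwoPlate`) used the twelve-ball readings; here, as in `…EndUniqueGen`, only the SHAPE of the move is used
(straight `t = p + d` of any kind — FULL, GLIDE, NARROW — or cross `t = p − M_m d`), so the result covers `v2`:

* `word_dir_reflect_eq_len` — `word_dir_reflect_eq` with the length bookkeeping `|κ'| = |κ| ± 1`;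
* `word_dir_reflect_eq_basal` — the same for basal-letter chains `l ++ [e]`: the crossed direction is the direction
  of `l' ++ [e]` with `|l'| = |l| ± 1` (the deepest letter never cancels: `⟪d, m⟫ = ±√(2/3) ≠ 0 = ⟪r, e⟫`);
* **`word_target_ne_twoPlate_shape`** — the targets at one ball of a bottom class `(F κ₁, F κ₁ ((−1)^{|κ₁|} r))` and a
  top class `(F (l₂ ++ [e]), F (l₂ ++ [e]) ((−1)^{|l₂|+1} r))` never coincide: every target is `p + d(κ')` for the
  ARRIVAL chain `κ'` of the same type, and `d`-equality glues `κ₁' ++ [e] ++ l₂'.reverse` into a `±1/3`-chain taking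
  the slot `±r` to a lattice vector — excluded by `foldl_reflect_not_mem_fcc` (or, with both arrival chains trivial,
  reads `r = −r`).
WHAT THIS IS NOT: the two-plate cells themselves (next files); F-C1 not moved.
-/

noncomputable section

namespace Summit.Ventures.Crystal3D.Theorems

open Summit.Ventures.Crystal3D Finset
open Literature.MathematicalPhysics.StatisticalMechanics (fccStacking)
open scoped InnerProductSpace

variable {F : List (EuclideanSpace ℝ (Fin 3)) → (EuclideanSpace ℝ (Fin 3) ≃ₗᵢ[ℝ] EuclideanSpace ℝ (Fin 3))}

/-- `word_dir_reflect_eq` with the length of the new chain: `|κ'| = |κ| + 1` (push) or `|κ| = |κ'| + 1` (pop). -/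
theorem word_dir_reflect_eq_len (hFc : ∀ μ κ, F (μ :: κ) = ((ℝ ∙ μ)ᗮ.reflection).trans (F κ))
    {κ : List (EuclideanSpace ℝ (Fin 3))}
    (hκ : ∀ μ ∈ κ, ‖μ‖ = 1 ∧
      ∀ w ∈ fccSlots, ⟪w, μ⟫_ℝ = 0 ∨ ⟪w, μ⟫_ℝ = Real.sqrt (2 / 3) ∨ ⟪w, μ⟫_ℝ = -Real.sqrt (2 / 3))
    (hch : List.IsChain (fun μ μ' => ⟪μ, μ'⟫_ℝ = 1 / 3 ∨ ⟪μ, μ'⟫_ℝ = -1 / 3) κ)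
    {x : EuclideanSpace ℝ (Fin 3)}
    (hob : ∀ μ ∈ κ, ⟪x, μ⟫_ℝ = Real.sqrt (2 / 3) ∨ ⟪x, μ⟫_ℝ = -Real.sqrt (2 / 3))
    {m : EuclideanSpace ℝ (Fin 3)} (hm : ‖m‖ = 1)
    (hmenu : ∀ w ∈ fccSlots, ⟪F κ w, m⟫_ℝ = 0 ∨ ⟪F κ w, m⟫_ℝ = Real.sqrt (2 / 3) ∨ ⟪F κ w, m⟫_ℝ = -Real.sqrt (2 / 3))
    (hcross : ⟪F κ x, m⟫_ℝ = Real.sqrt (2 / 3) ∨ ⟪F κ x, m⟫_ℝ = -Real.sqrt (2 / 3)) :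
    ∃ κ' : List (EuclideanSpace ℝ (Fin 3)),
      (∀ μ ∈ κ', ‖μ‖ = 1 ∧
        ∀ w ∈ fccSlots, ⟪w, μ⟫_ℝ = 0 ∨ ⟪w, μ⟫_ℝ = Real.sqrt (2 / 3) ∨ ⟪w, μ⟫_ℝ = -Real.sqrt (2 / 3)) ∧
      List.IsChain (fun μ μ' => ⟪μ, μ'⟫_ℝ = 1 / 3 ∨ ⟪μ, μ'⟫_ℝ = -1 / 3) κ' ∧
      (∀ μ ∈ κ', ⟪x, μ⟫_ℝ = Real.sqrt (2 / 3) ∨ ⟪x, μ⟫_ℝ = -Real.sqrt (2 / 3)) ∧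
      F κ x - (2 * ⟪F κ x, m⟫_ℝ) • m = F κ' x ∧ (κ'.length = κ.length + 1 ∨ κ.length = κ'.length + 1) := by
  obtain ⟨μ, hFμ, hμ1⟩ : ∃ μ : EuclideanSpace ℝ (Fin 3), F κ μ = m ∧ ‖μ‖ = 1 :=
    ⟨(F κ).symm m, (F κ).apply_symm_apply m, by rw [LinearIsometryEquiv.norm_map, hm]⟩
  have hμmenu : ∀ w ∈ fccSlots, ⟪w, μ⟫_ℝ = 0 ∨ ⟪w, μ⟫_ℝ = Real.sqrt (2 / 3) ∨ ⟪w, μ⟫_ℝ = -Real.sqrt (2 / 3) := by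
    intro w hw
    have := hmenu w hw
    rwa [← hFμ, LinearIsometryEquiv.inner_map_map] at this
  have hμob : ⟪x, μ⟫_ℝ = Real.sqrt (2 / 3) ∨ ⟪x, μ⟫_ℝ = -Real.sqrt (2 / 3) := by
    have := hcross
    rwa [← hFμ, LinearIsometryEquiv.inner_map_map] at this
  have hconj : F κ x - (2 * ⟪F κ x, m⟫_ℝ) • m = F (μ :: κ) x := by
    rw [word_F_cons_apply hFc hμ1 κ x, map_sub, LinearIsometryEquiv.map_smul, hFμ, ← hFμ,
      LinearIsometryEquiv.inner_map_map]
  by_cases hcancel : ∃ ν κ₀, κ = ν :: κ₀ ∧ (μ = ν ∨ μ = -ν)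
  · obtain ⟨ν, κ₀, hκν, hμν⟩ := hcancel
    subst hκν
    have hν1 : ‖ν‖ = 1 := (hκ ν (by simp)).1
    refine ⟨κ₀, fun μ' hμ' => hκ μ' (by simp [hμ']), (List.isChain_cons.1 hch).2,
      fun μ' hμ' => hob μ' (by simp [hμ']), ?_, Or.inr (by rw [List.length_cons])⟩
    rw [hconj, word_F_cons_apply hFc hμ1, word_F_cons_apply hFc hν1]
    congr 1
    rcases hμν with rfl | rfl
    · exact reflect_reflect_unit hμ1 x
    · rw [reflect_neg_eq x ν]; exact reflect_reflect_unit hν1 x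
  · refine ⟨μ :: κ, ?_, ?_, ?_, hconj, Or.inl (by rw [List.length_cons])⟩
    · intro μ' hμ'
      rcases List.mem_cons.1 hμ' with rfl | h
      · exact ⟨hμ1, hμmenu⟩
      · exact hκ μ' h
    · rw [List.isChain_cons]
      refine ⟨fun ν hν => ?_, hch⟩
      obtain ⟨κ₀, rfl⟩ : ∃ κ₀, κ = ν :: κ₀ := by
        cases κ with
        | nil => simp at hν
        | cons a l =>
          rw [List.head?_cons, Option.mem_def, Option.some.injEq] at hν
          exact ⟨l, by rw [hν]⟩
      have hν := hκ ν (by simp)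
      have hne : μ ≠ ν := fun h => hcancel ⟨ν, κ₀, rfl, Or.inl h⟩
      have hne' : ν ≠ -μ := fun h => hcancel ⟨ν, κ₀, rfl, Or.inr (by rw [h, neg_neg])⟩
      exact menuNormals_chain_of_ne_of_ne_neg hμ1 hν.1 hμmenu hν.2 hne hne'
    · intro μ' hμ'
      rcases List.mem_cons.1 hμ' with rfl | h
      · exact hμob
      · exact hob μ' h

/-- **A crossed direction of a basal-letter chain is a direction of a basal-letter chain.**  See the module
docstring.  The deepest letter `e` is orthogonal to `x` and never cancels. -/
theorem word_dir_reflect_eq_basal (hFc : ∀ μ κ, F (μ :: κ) = ((ℝ ∙ μ)ᗮ.reflection).trans (F κ))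
    {l : List (EuclideanSpace ℝ (Fin 3))} {e x : EuclideanSpace ℝ (Fin 3)}
    (hl : ∀ μ ∈ l, ‖μ‖ = 1 ∧
      ∀ w ∈ fccSlots, ⟪w, μ⟫_ℝ = 0 ∨ ⟪w, μ⟫_ℝ = Real.sqrt (2 / 3) ∨ ⟪w, μ⟫_ℝ = -Real.sqrt (2 / 3))
    (he1 : ‖e‖ = 1)
    (hemenu : ∀ w ∈ fccSlots, ⟪w, e⟫_ℝ = 0 ∨ ⟪w, e⟫_ℝ = Real.sqrt (2 / 3) ∨ ⟪w, e⟫_ℝ = -Real.sqrt (2 / 3))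
    (hxe : ⟪x, e⟫_ℝ = 0)
    (hch : List.IsChain (fun μ μ' => ⟪μ, μ'⟫_ℝ = 1 / 3 ∨ ⟪μ, μ'⟫_ℝ = -1 / 3) (l ++ [e]))
    (hob : ∀ μ ∈ l, ⟪x, μ⟫_ℝ = Real.sqrt (2 / 3) ∨ ⟪x, μ⟫_ℝ = -Real.sqrt (2 / 3))
    {m : EuclideanSpace ℝ (Fin 3)} (hm : ‖m‖ = 1)
    (hmenu : ∀ w ∈ fccSlots, ⟪F (l ++ [e]) w, m⟫_ℝ = 0 ∨ ⟪F (l ++ [e]) w, m⟫_ℝ = Real.sqrt (2 / 3) ∨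
      ⟪F (l ++ [e]) w, m⟫_ℝ = -Real.sqrt (2 / 3))
    (hcross : ⟪F (l ++ [e]) x, m⟫_ℝ = Real.sqrt (2 / 3) ∨ ⟪F (l ++ [e]) x, m⟫_ℝ = -Real.sqrt (2 / 3)) :
    ∃ l' : List (EuclideanSpace ℝ (Fin 3)),
      (∀ μ ∈ l', ‖μ‖ = 1 ∧
        ∀ w ∈ fccSlots, ⟪w, μ⟫_ℝ = 0 ∨ ⟪w, μ⟫_ℝ = Real.sqrt (2 / 3) ∨ ⟪w, μ⟫_ℝ = -Real.sqrt (2 / 3)) ∧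
      List.IsChain (fun μ μ' => ⟪μ, μ'⟫_ℝ = 1 / 3 ∨ ⟪μ, μ'⟫_ℝ = -1 / 3) (l' ++ [e]) ∧
      (∀ μ ∈ l', ⟪x, μ⟫_ℝ = Real.sqrt (2 / 3) ∨ ⟪x, μ⟫_ℝ = -Real.sqrt (2 / 3)) ∧
      F (l ++ [e]) x - (2 * ⟪F (l ++ [e]) x, m⟫_ℝ) • m = F (l' ++ [e]) x ∧
      (l'.length = l.length + 1 ∨ l.length = l'.length + 1) := by
  have hr : 0 < Real.sqrt (2 / 3) := Real.sqrt_pos.2 (by norm_num)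
  obtain ⟨μ, hFμ, hμ1⟩ : ∃ μ : EuclideanSpace ℝ (Fin 3), F (l ++ [e]) μ = m ∧ ‖μ‖ = 1 :=
    ⟨(F (l ++ [e])).symm m, (F (l ++ [e])).apply_symm_apply m, by rw [LinearIsometryEquiv.norm_map, hm]⟩
  have hμmenu : ∀ w ∈ fccSlots, ⟪w, μ⟫_ℝ = 0 ∨ ⟪w, μ⟫_ℝ = Real.sqrt (2 / 3) ∨ ⟪w, μ⟫_ℝ = -Real.sqrt (2 / 3) := by
    intro w hw
    have := hmenu w hw
    rwa [← hFμ, LinearIsometryEquiv.inner_map_map] at this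
  have hμob : ⟪x, μ⟫_ℝ = Real.sqrt (2 / 3) ∨ ⟪x, μ⟫_ℝ = -Real.sqrt (2 / 3) := by
    have := hcross
    rwa [← hFμ, LinearIsometryEquiv.inner_map_map] at this
  -- the new letter is oblique to `x`, hence `μ ≠ ±e`
  have hμe : μ ≠ e ∧ μ ≠ -e := by
    constructor
    · intro h; rw [h, hxe] at hμob; rcases hμob with h' | h' <;> linarith
    · intro h; rw [h, inner_neg_right, hxe, neg_zero] at hμob; rcases hμob with h' | h' <;> linarith
  have hconj : F (l ++ [e]) x - (2 * ⟪F (l ++ [e]) x, m⟫_ℝ) • m = F (μ :: (l ++ [e])) x := by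
    rw [word_F_cons_apply hFc hμ1 (l ++ [e]) x, map_sub, LinearIsometryEquiv.map_smul, hFμ, ← hFμ,
      LinearIsometryEquiv.inner_map_map]
  by_cases hcancel : ∃ ν l₀, l = ν :: l₀ ∧ (μ = ν ∨ μ = -ν)
  · -- pop the head of `l`
    obtain ⟨ν, l₀, hlν, hμν⟩ := hcancel
    subst hlν
    have hν1 : ‖ν‖ = 1 := (hl ν (by simp)).1
    have hch' : List.IsChain (fun μ μ' => ⟪μ, μ'⟫_ℝ = 1 / 3 ∨ ⟪μ, μ'⟫_ℝ = -1 / 3) (l₀ ++ [e]) := by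
      rw [List.cons_append] at hch; exact (List.isChain_cons.1 hch).2
    refine ⟨l₀, fun μ' hμ' => hl μ' (by simp [hμ']), hch', fun μ' hμ' => hob μ' (by simp [hμ']), ?_,
      Or.inr (by rw [List.length_cons])⟩
    rw [hconj, word_F_cons_apply hFc hμ1, List.cons_append, word_F_cons_apply hFc hν1]
    congr 1
    rcases hμν with rfl | rfl
    · exact reflect_reflect_unit hμ1 x
    · rw [reflect_neg_eq x ν]; exact reflect_reflect_unit hν1 x
  · -- push `μ`
    refine ⟨μ :: l, ?_, ?_, ?_, by rw [List.cons_append]; exact hconj, Or.inl (by rw [List.length_cons])⟩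
    · intro μ' hμ'
      rcases List.mem_cons.1 hμ' with rfl | h
      · exact ⟨hμ1, hμmenu⟩
      · exact hl μ' h
    · rw [List.cons_append, List.isChain_cons]
      refine ⟨fun ν hν => ?_, hch⟩
      -- `ν` is the head of `l ++ [e]`
      cases l with
      | nil =>
        rw [List.nil_append, List.head?_cons, Option.mem_def, Option.some.injEq] at hν
        subst hν
        exact menuNormals_chain_of_ne_of_ne_neg hμ1 he1 hμmenu hemenu hμe.1 fun h => hμe.2 (by rw [h, neg_neg])
      | cons a l₀ =>
        rw [List.cons_append, List.head?_cons, Option.mem_def, Option.some.injEq] at hν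
        subst hν
        have ha := hl a (by simp)
        have hne : μ ≠ a := fun h => hcancel ⟨a, l₀, rfl, Or.inl h⟩
        have hne' : a ≠ -μ := fun h => hcancel ⟨a, l₀, rfl, Or.inr (by rw [h, neg_neg])⟩
        exact menuNormals_chain_of_ne_of_ne_neg hμ1 ha.1 hμmenu ha.2 hne hne'
    · intro μ' hμ'
      rcases List.mem_cons.1 hμ' with rfl | h
      · exact hμob
      · exact hob μ' h

/-- **LEMMA X″ (all versions): a bottom class and a top class of one in-plane root never share a target.**  See the
module docstring. -/
theorem word_target_ne_twoPlate_shape (hFc : ∀ μ κ, F (μ :: κ) = ((ℝ ∙ μ)ᗮ.reflection).trans (F κ))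
    {κ₁ l₂ : List (EuclideanSpace ℝ (Fin 3))} {e r : EuclideanSpace ℝ (Fin 3)} (hr : r ∈ fccSlots)
    (hκ₁ : ∀ μ ∈ κ₁, ‖μ‖ = 1 ∧
      ∀ w ∈ fccSlots, ⟪w, μ⟫_ℝ = 0 ∨ ⟪w, μ⟫_ℝ = Real.sqrt (2 / 3) ∨ ⟪w, μ⟫_ℝ = -Real.sqrt (2 / 3))
    (hch₁ : List.IsChain (fun μ μ' => ⟪μ, μ'⟫_ℝ = 1 / 3 ∨ ⟪μ, μ'⟫_ℝ = -1 / 3) κ₁)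
    (hob₁ : ∀ μ ∈ κ₁, ⟪r, μ⟫_ℝ = Real.sqrt (2 / 3) ∨ ⟪r, μ⟫_ℝ = -Real.sqrt (2 / 3))
    (he1 : ‖e‖ = 1)
    (hemenu : ∀ w ∈ fccSlots, ⟪w, e⟫_ℝ = 0 ∨ ⟪w, e⟫_ℝ = Real.sqrt (2 / 3) ∨ ⟪w, e⟫_ℝ = -Real.sqrt (2 / 3))
    (hre : ⟪r, e⟫_ℝ = 0)
    (hl₂ : ∀ μ ∈ l₂, ‖μ‖ = 1 ∧
      ∀ w ∈ fccSlots, ⟪w, μ⟫_ℝ = 0 ∨ ⟪w, μ⟫_ℝ = Real.sqrt (2 / 3) ∨ ⟪w, μ⟫_ℝ = -Real.sqrt (2 / 3))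
    (hch₂ : List.IsChain (fun μ μ' => ⟪μ, μ'⟫_ℝ = 1 / 3 ∨ ⟪μ, μ'⟫_ℝ = -1 / 3) (l₂ ++ [e]))
    (hob₂ : ∀ μ ∈ l₂, ⟪r, μ⟫_ℝ = Real.sqrt (2 / 3) ∨ ⟪r, μ⟫_ℝ = -Real.sqrt (2 / 3))
    {d₁ d₂ : EuclideanSpace ℝ (Fin 3)} (hd₁ : d₁ = F κ₁ (((-1 : ℝ) ^ κ₁.length) • r))
    (hd₂ : d₂ = F (l₂ ++ [e]) (((-1 : ℝ) ^ (l₂ ++ [e]).length) • r))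
    {p t₁ t₂ : EuclideanSpace ℝ (Fin 3)}
    (hT₁ : t₁ = p + d₁ ∨ ∃ m : EuclideanSpace ℝ (Fin 3), ‖m‖ = 1 ∧
      (∀ w ∈ fccSlots, ⟪F κ₁ w, m⟫_ℝ = 0 ∨ ⟪F κ₁ w, m⟫_ℝ = Real.sqrt (2 / 3) ∨ ⟪F κ₁ w, m⟫_ℝ = -Real.sqrt (2 / 3)) ∧
      ⟪d₁, m⟫_ℝ = Real.sqrt (2 / 3) ∧ t₁ = p - (d₁ - (2 * ⟪d₁, m⟫_ℝ) • m))
    (hT₂ : t₂ = p + d₂ ∨ ∃ m : EuclideanSpace ℝ (Fin 3), ‖m‖ = 1 ∧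
      (∀ w ∈ fccSlots, ⟪F (l₂ ++ [e]) w, m⟫_ℝ = 0 ∨ ⟪F (l₂ ++ [e]) w, m⟫_ℝ = Real.sqrt (2 / 3) ∨
        ⟪F (l₂ ++ [e]) w, m⟫_ℝ = -Real.sqrt (2 / 3)) ∧
      ⟪d₂, m⟫_ℝ = Real.sqrt (2 / 3) ∧ t₂ = p - (d₂ - (2 * ⟪d₂, m⟫_ℝ) • m)) :
    t₁ ≠ t₂ := by
  have hr0 : 0 < Real.sqrt (2 / 3) := Real.sqrt_pos.2 (by norm_num)
  -- obliqueness survives a sign, and sign bookkeeping `(-1)^(n ± 1) = -(-1)^n`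
  have ob_smul : ∀ {κ : List (EuclideanSpace ℝ (Fin 3))} (n : ℕ),
      (∀ μ ∈ κ, ⟪r, μ⟫_ℝ = Real.sqrt (2 / 3) ∨ ⟪r, μ⟫_ℝ = -Real.sqrt (2 / 3)) →
      ∀ μ ∈ κ, ⟪((-1 : ℝ) ^ n) • r, μ⟫_ℝ = Real.sqrt (2 / 3) ∨ ⟪((-1 : ℝ) ^ n) • r, μ⟫_ℝ = -Real.sqrt (2 / 3) := by
    intro κ n hob μ hμ
    rw [real_inner_smul_left]
    rcases neg_one_pow_eq_or ℝ n with h | h <;> rcases hob μ hμ with h' | h' <;> rw [h, h']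
    · left; ring
    · right; ring
    · right; ring
    · left; ring
  have ob_of_smul : ∀ {κ : List (EuclideanSpace ℝ (Fin 3))} (n : ℕ),
      (∀ μ ∈ κ, ⟪((-1 : ℝ) ^ n) • r, μ⟫_ℝ = Real.sqrt (2 / 3) ∨ ⟪((-1 : ℝ) ^ n) • r, μ⟫_ℝ = -Real.sqrt (2 / 3)) →
      ∀ μ ∈ κ, ⟪r, μ⟫_ℝ = Real.sqrt (2 / 3) ∨ ⟪r, μ⟫_ℝ = -Real.sqrt (2 / 3) := by
    intro κ n hob μ hμ
    have h0 := hob μ hμ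
    rw [real_inner_smul_left] at h0
    rcases neg_one_pow_eq_or ℝ n with h | h <;> rw [h] at h0 <;> rcases h0 with h' | h'
    · left; linarith
    · right; linarith
    · right; linarith
    · left; linarith
  have pow_step : ∀ {a b : ℕ}, (a = b + 1 ∨ b = a + 1) → ((-1 : ℝ) ^ a) = -((-1 : ℝ) ^ b) := by
    rintro a b (rfl | rfl)
    · rw [pow_succ]; ring
    · rw [pow_succ]; ring
  -- (A) the bottom target is `p + F κ₁' ((-1)^|κ₁'| • r)` for an all-oblique arrival chain `κ₁'`
  obtain ⟨κ₁', hκ₁', hch₁', hob₁', ht₁⟩ : ∃ κ₁' : List (EuclideanSpace ℝ (Fin 3)),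
      (∀ μ ∈ κ₁', ‖μ‖ = 1 ∧
        ∀ w ∈ fccSlots, ⟪w, μ⟫_ℝ = 0 ∨ ⟪w, μ⟫_ℝ = Real.sqrt (2 / 3) ∨ ⟪w, μ⟫_ℝ = -Real.sqrt (2 / 3)) ∧
      List.IsChain (fun μ μ' => ⟪μ, μ'⟫_ℝ = 1 / 3 ∨ ⟪μ, μ'⟫_ℝ = -1 / 3) κ₁' ∧
      (∀ μ ∈ κ₁', ⟪r, μ⟫_ℝ = Real.sqrt (2 / 3) ∨ ⟪r, μ⟫_ℝ = -Real.sqrt (2 / 3)) ∧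
      t₁ = p + F κ₁' (((-1 : ℝ) ^ κ₁'.length) • r) := by
    rcases hT₁ with rfl | ⟨m, hm, hmenu, hdm, rfl⟩
    · exact ⟨κ₁, hκ₁, hch₁, hob₁, by rw [hd₁]⟩
    · have hcross : ⟪F κ₁ (((-1 : ℝ) ^ κ₁.length) • r), m⟫_ℝ = Real.sqrt (2 / 3) ∨
          ⟪F κ₁ (((-1 : ℝ) ^ κ₁.length) • r), m⟫_ℝ = -Real.sqrt (2 / 3) := Or.inl (by rw [← hd₁]; exact hdm)
      obtain ⟨κ', hκ', hch', hob', heq, hlen⟩ :=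
        word_dir_reflect_eq_len hFc hκ₁ hch₁ (ob_smul κ₁.length hob₁) hm hmenu hcross
      refine ⟨κ', hκ', hch', ob_of_smul κ₁.length hob', ?_⟩
      rw [hd₁, heq, pow_step hlen, neg_smul, map_neg, sub_eq_add_neg]
  -- (B) the top target is `p + F (l₂' ++ [e]) ((-1)^(|l₂'|+1) • r)` for a basal-letter arrival chain
  obtain ⟨l₂', hl₂', hch₂', hob₂', ht₂⟩ : ∃ l₂' : List (EuclideanSpace ℝ (Fin 3)),
      (∀ μ ∈ l₂', ‖μ‖ = 1 ∧
        ∀ w ∈ fccSlots, ⟪w, μ⟫_ℝ = 0 ∨ ⟪w, μ⟫_ℝ = Real.sqrt (2 / 3) ∨ ⟪w, μ⟫_ℝ = -Real.sqrt (2 / 3)) ∧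
      List.IsChain (fun μ μ' => ⟪μ, μ'⟫_ℝ = 1 / 3 ∨ ⟪μ, μ'⟫_ℝ = -1 / 3) (l₂' ++ [e]) ∧
      (∀ μ ∈ l₂', ⟪r, μ⟫_ℝ = Real.sqrt (2 / 3) ∨ ⟪r, μ⟫_ℝ = -Real.sqrt (2 / 3)) ∧
      t₂ = p + F (l₂' ++ [e]) (((-1 : ℝ) ^ (l₂' ++ [e]).length) • r) := by
    rcases hT₂ with rfl | ⟨m, hm, hmenu, hdm, rfl⟩
    · exact ⟨l₂, hl₂, hch₂, hob₂, by rw [hd₂]⟩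
    · have hxe : ⟪((-1 : ℝ) ^ (l₂ ++ [e]).length) • r, e⟫_ℝ = 0 := by rw [real_inner_smul_left, hre, mul_zero]
      have hcross : ⟪F (l₂ ++ [e]) (((-1 : ℝ) ^ (l₂ ++ [e]).length) • r), m⟫_ℝ = Real.sqrt (2 / 3) ∨
          ⟪F (l₂ ++ [e]) (((-1 : ℝ) ^ (l₂ ++ [e]).length) • r), m⟫_ℝ = -Real.sqrt (2 / 3) :=
        Or.inl (by rw [← hd₂]; exact hdm)
      obtain ⟨l', hl', hch', hob', heq, hlen⟩ :=
        word_dir_reflect_eq_basal hFc hl₂ he1 hemenu hxe hch₂ (ob_smul (l₂ ++ [e]).length hob₂) hm hmenu hcross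
      refine ⟨l', hl', hch', ob_of_smul (l₂ ++ [e]).length hob', ?_⟩
      have hlen' : (l' ++ [e]).length = (l₂ ++ [e]).length + 1 ∨ (l₂ ++ [e]).length = (l' ++ [e]).length + 1 := by
        simp only [List.length_append, List.length_singleton]; omega
      rw [hd₂, heq, pow_step hlen', neg_smul, map_neg, sub_eq_add_neg]
  -- (C) equal targets ⇒ equal arrival directions ⇒ a forbidden mirror chain
  intro heqt
  rw [ht₁, ht₂] at heqt
  have hdir : F κ₁' (((-1 : ℝ) ^ κ₁'.length) • r) = F (l₂' ++ [e]) (((-1 : ℝ) ^ (l₂' ++ [e]).length) • r) :=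
    add_left_cancel heqt
  have hu₁ : ∀ μ ∈ κ₁', ‖μ‖ = 1 := fun μ hμ => (hκ₁' μ hμ).1
  have hl₂'u : ∀ μ ∈ l₂', ‖μ‖ = 1 := fun μ hμ => (hl₂' μ hμ).1
  have hu₂ : ∀ μ ∈ l₂' ++ [e], ‖μ‖ = 1 := by
    intro μ hμ
    rcases List.mem_append.1 hμ with h | h
    · exact hl₂'u μ h
    · rw [List.mem_singleton.1 h]; exact he1
  -- slots and obliqueness with the signs, then forget the exponents
  have hslot : ∀ n : ℕ, ((-1 : ℝ) ^ n) • r ∈ fccSlots := by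
    intro n
    rcases neg_one_pow_eq_or ℝ n with h | h <;> rw [h]
    · rw [one_smul]; exact hr
    · rw [neg_one_smul]; exact neg_mem_fccSlots hr
  have hs₁ := hslot κ₁'.length
  have hs₂ := hslot (l₂' ++ [e]).length
  have hobs₁ := ob_smul κ₁'.length hob₁'
  have hobs₂ := ob_smul (l₂' ++ [e]).length hob₂'
  have hc₁val : κ₁' = [] → ((-1 : ℝ) ^ κ₁'.length) = 1 := by intro h; rw [h, List.length_nil, pow_zero]
  have hc₂val : l₂' = [] → ((-1 : ℝ) ^ (l₂' ++ [e]).length) = -1 := by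
    intro h; rw [h, List.nil_append, List.length_singleton, pow_one]
  generalize ((-1 : ℝ) ^ κ₁'.length) = c₁ at hs₁ hobs₁ hdir hc₁val
  generalize ((-1 : ℝ) ^ (l₂' ++ [e]).length) = c₂ at hs₂ hobs₂ hdir hc₂val
  have hRre : ∀ c : ℝ, c • r - (2 * ⟪c • r, e⟫_ℝ) • e = c • r := by
    intro c; rw [real_inner_smul_left, hre, mul_zero, mul_zero, zero_smul, sub_zero]
  -- peel the base frame: `foldl κ₁' (c₁ r) = M_e (foldl l₂' (c₂ r))`
  have hfold : κ₁'.foldl (fun (y : EuclideanSpace ℝ (Fin 3)) μ => y - (2 * ⟪y, μ⟫_ℝ) • μ) (c₁ • r) =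
      l₂'.foldl (fun (y : EuclideanSpace ℝ (Fin 3)) μ => y - (2 * ⟪y, μ⟫_ℝ) • μ) (c₂ • r) -
        (2 * ⟪l₂'.foldl (fun (y : EuclideanSpace ℝ (Fin 3)) μ => y - (2 * ⟪y, μ⟫_ℝ) • μ) (c₂ • r), e⟫_ℝ) • e := by
    have e₁ := word_F_append_apply hFc κ₁' hu₁ [] (c₁ • r)
    have e₂ := word_F_append_apply hFc (l₂' ++ [e]) hu₂ [] (c₂ • r)
    rw [List.append_nil] at e₁ e₂
    rw [e₁, e₂] at hdir
    have := (F []).injective hdir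
    simpa only [List.foldl_append, List.foldl_cons, List.foldl_nil] using this
  by_cases h1 : κ₁' = []
  · -- trivial bottom arrival chain: `c₁ = 1`
    rw [h1, List.foldl_nil, hc₁val h1, one_smul] at hfold
    -- `foldl l₂' (c₂ r) = M_e r = r`
    have hfix : l₂'.foldl (fun (y : EuclideanSpace ℝ (Fin 3)) μ => y - (2 * ⟪y, μ⟫_ℝ) • μ) (c₂ • r) = r := by
      have h := reflect_reflect_unit he1
        (l₂'.foldl (fun (y : EuclideanSpace ℝ (Fin 3)) μ => y - (2 * ⟪y, μ⟫_ℝ) • μ) (c₂ • r))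
      rw [← hfold, hre, mul_zero, zero_smul, sub_zero] at h
      exact h.symm
    by_cases h2 : l₂' = []
    · -- both trivial: `r = -r`
      rw [h2, List.foldl_nil, hc₂val h2, neg_one_smul] at hfix
      have h2r : (2 : ℝ) • r = 0 := by
        rw [two_smul]
        calc r + r = -r + r := by rw [hfix]
          _ = 0 := neg_add_cancel r
      have h0 : r = 0 := (smul_eq_zero.1 h2r).resolve_left two_ne_zero
      have hn := norm_eq_one_of_mem_fccSlots hr
      rw [h0, norm_zero] at hn
      exact zero_ne_one hn
    · obtain ⟨ν, l₀, hl₀⟩ := List.exists_cons_of_ne_nil h2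
      have hchl : List.IsChain (fun μ μ' => ⟪μ, μ'⟫_ℝ = 1 / 3 ∨ ⟪μ, μ'⟫_ℝ = -1 / 3) l₂' := hch₂'.left_of_append
      rw [hl₀] at hfix hchl
      have key := foldl_reflect_not_mem_fcc ν l₀ (fun μ hμ => hl₂' μ (by rw [hl₀]; exact hμ)) hchl hs₂
        (hobs₂ ν (by rw [hl₀]; exact List.mem_cons_self))
      rw [hfix] at key
      exact key (mem_fcc_of_mem_fccSlots hr)
  · -- nonempty bottom arrival chain: glue `κ₁' ++ (e :: l₂'.reverse)`
    obtain ⟨μ₁, g, hg⟩ := List.exists_cons_of_ne_nil h1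
    have hglue : (κ₁' ++ (e :: l₂'.reverse)).foldl (fun (y : EuclideanSpace ℝ (Fin 3)) μ => y - (2 * ⟪y, μ⟫_ℝ) • μ)
        (c₁ • r) = c₂ • r := by
      simp only [List.foldl_append, List.foldl_cons, hfold]
      rw [reflect_reflect_unit he1]
      exact foldl_reflect_reverse_foldl l₂' hl₂'u _
    have hletg : ∀ μ ∈ κ₁' ++ (e :: l₂'.reverse), ‖μ‖ = 1 ∧
        ∀ w ∈ fccSlots, ⟪w, μ⟫_ℝ = 0 ∨ ⟪w, μ⟫_ℝ = Real.sqrt (2 / 3) ∨ ⟪w, μ⟫_ℝ = -Real.sqrt (2 / 3) := by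
      intro μ hμ
      rcases List.mem_append.1 hμ with h | h
      · exact hκ₁' μ h
      · rcases List.mem_cons.1 h with rfl | h'
        · exact ⟨he1, hemenu⟩
        · exact hl₂' μ (List.mem_reverse.1 h')
    have hchg : List.IsChain (fun μ μ' => ⟪μ, μ'⟫_ℝ = 1 / 3 ∨ ⟪μ, μ'⟫_ℝ = -1 / 3) (κ₁' ++ (e :: l₂'.reverse)) := by
      rw [List.isChain_append]
      refine ⟨hch₁', ?_, ?_⟩
      · have : e :: l₂'.reverse = (l₂' ++ [e]).reverse := by
          rw [List.reverse_append, List.reverse_singleton, List.singleton_append]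
        rw [this, List.isChain_reverse]
        exact hch₂'.imp fun a b h => by rw [real_inner_comm]; exact h
      · intro x hx y hy
        rw [List.head?_cons, Option.mem_def, Option.some.injEq] at hy
        subst hy
        obtain ⟨hx1, hxm⟩ := hκ₁' x (List.mem_of_getLast? hx)
        have hxob := hob₁' x (List.mem_of_getLast? hx)
        refine menuNormals_chain_of_ne_of_ne_neg hx1 he1 hxm hemenu ?_ ?_
        · intro h; rw [h, hre] at hxob; rcases hxob with h' | h' <;> linarith
        · intro h
          have : ⟪r, x⟫_ℝ = 0 := by
            have := hre; rw [h, inner_neg_right, neg_eq_zero] at this; exact this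
          rw [this] at hxob; rcases hxob with h' | h' <;> linarith
    rw [hg, List.cons_append] at hglue hletg hchg
    have key := foldl_reflect_not_mem_fcc μ₁ (g ++ (e :: l₂'.reverse)) hletg hchg hs₁
      (hobs₁ μ₁ (by rw [hg]; exact List.mem_cons_self))
    rw [hglue] at key
    exact key (mem_fcc_of_mem_fccSlots hs₂)

end Summit.Ventures.Crystal3D.Theorems

end
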